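import Mathlib
import HarnessLib
import Literature.MathematicalPhysics.StatisticalMechanics.LinearisedMapABKMContraction
import Literature.MathematicalPhysics.StatisticalMechanics.FluctuationOfHamiltonian
import Literature.MathematicalPhysics.StatisticalMechanics.LatticeSobolevLine

/-!
# Lemma 10.5 of [ABKM19] for the concrete torus data: `‖(A_k)⁻¹‖ ≤ ¾` at the scales
# `(𝔥_k, L^k, L^{dk}) → (𝔥_{k+1}, L^{k+1}, L^{d(k+1)})`, and the bound `|γ_q| ≤ C_{2,0} L^{−dk}`

`RelevantHamiltonianStepOperator.hamNorm_stepOpAInv_le` is Lemma 10.5 for abstract weights under four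
comparison hypotheses.  Here they are VERIFIED for the weights of [ABKM19]: coefficient-norm
parameters `(𝔥, R, n) = (fieldWt h L d k, L^k, L^{dk})` at scale `k` and the same at `k+1`
(`𝔥_{k+1} = κ_L 𝔥_k`, `κ_L = 2L^{−(d−2)/2}`), for `d ≥ 3`, `L ≥ 4`, multi-indices with
`2|α| ≤ d + 2` (all of `linIndex d`), and a shift `γ` with `L^{dk}|γ_q| ≤ h²` ((10.39):
`|γ_q| ≤ C_{2,0}L^{−kd}` and `h² ≥ C_{2,0}`):

* `abs_gradCov_eq_abs_iterDiff`, `abs_gradCov_le` — `γ_q = −(∇_i∇_j𝒞)(−e_j)`, so `|γ_q|` is bounded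
  by any bound on the second differences of the kernel (clause (iv) of the decomposition,
  `AbkmWeightBounds.regular`, gives `C L^{−kd}` for `𝒞_{k+1}`);
* the weight comparisons `abkm_weight_const`, `abkm_weight_lin`, `abkm_weight_quad`, `abkm_weight_shift`;
* **`hamNorm_stepOpAInv_abkm_le`** — `‖A_k⁻¹H'‖_{k,0} ≤ ¾‖H'‖_{k+1,0}` for the concrete scales.

Everything is proved; no named fact.

## References
* S. Adams, S. Buchholz, R. Kotecký, S. Müller, arXiv:1910.13564, Lemma 10.5 ((10.37)–(10.39)),
  Theorem 6.8 (6.63) [AdamsBuchholzKoteckyMuller2019].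
-/

noncomputable section

namespace Literature.MathematicalPhysics.StatisticalMechanics.GradientRG

open scoped BigOperators
open Finset
open Literature.MathematicalPhysics.StatisticalMechanics.GradientFRD (iterDiff fwdDiff)

variable {d M : ℕ}

/-! ## `γ_q` is a second difference of the kernel -/

/-- `γ_{ij} = −(∇_i ∇_j 𝒞)(−e_j)`. [cite: AdamsBuchholzKoteckyMuller2019, Theorem 6.8 (6.63)] -/
theorem gradCov_eq_neg_iterDiff (𝒞 : (Fin d → ZMod M) → ℝ) (q : quadIndex d) :
    gradCov 𝒞 q =
      -(iterDiff (Pi.single q.1.2 1 + Pi.single q.1.1 1) 𝒞 (-(Pi.single q.1.2 1 : Fin d → ZMod M))) := by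
  rw [iterDiff_add_single, iterDiff_single]
  unfold gradCov GradientFRD.fwdDiff
  have e1 : -(Pi.single q.1.2 1 : Fin d → ZMod M) + Pi.single q.1.1 1 + Pi.single q.1.2 1 =
      Pi.single q.1.1 1 := by abel
  have e2 : -(Pi.single q.1.2 1 : Fin d → ZMod M) + Pi.single q.1.1 1 =
      Pi.single q.1.1 1 - Pi.single q.1.2 1 := by abel
  have e3 : -(Pi.single q.1.2 1 : Fin d → ZMod M) + Pi.single q.1.2 1 = 0 := by abel
  rw [e1, e2, e3]
  ring

/-- **`|γ_q| ≤ C`** whenever all second differences of the kernel are bounded by `C`.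
[cite: AdamsBuchholzKoteckyMuller2019, Lemma 10.5 (10.39)] -/
theorem abs_gradCov_le {𝒞 : (Fin d → ZMod M) → ℝ} {C : ℝ}
    (h : ∀ θ' : Fin d → ℕ, ∑ i, θ' i = 2 → ∀ x, |iterDiff θ' 𝒞 x| ≤ C) (q : quadIndex d) :
    |gradCov 𝒞 q| ≤ C := by
  rw [gradCov_eq_neg_iterDiff, abs_neg]
  refine h _ ?_ _
  simp [Finset.sum_add_distrib, Pi.single_apply]

/-! ## The weight comparisons of two consecutive scales -/

section Weights

variable {L k : ℕ} {h : ℝ}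

/-- `κ_L² · L^{d−2} = 4`. [cite: AdamsBuchholzKoteckyMuller2019, Lemma 8.1] -/
theorem scaleRatio_sq_mul {d L : ℕ} (hL : 0 < L) : scaleRatio d L ^ 2 * (L : ℝ) ^ (d - 2) = 4 := by
  unfold scaleRatio
  have hp : (0 : ℝ) < (L : ℝ) ^ (d - 2) := by positivity
  rw [div_pow, Real.sq_sqrt hp.le]
  field_simp
  norm_num

/-- constant weights: `L^{dk} ≤ ½ L^{d(k+1)}` for `L^d ≥ 2`. [cite: AdamsBuchholzKoteckyMuller2019, Lemma 10.5 (10.38)] -/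
theorem abkm_weight_const (hd : 1 ≤ d) (hL : 2 ≤ L) (k : ℕ) :
    ((L ^ (d * k) : ℕ) : ℝ) ≤ (1 / 2 : ℝ) * ((L ^ (d * (k + 1)) : ℕ) : ℝ) := by
  have h2 : (2 : ℝ) ≤ (L : ℝ) ^ d := by
    have : (2 : ℝ) ≤ L := by exact_mod_cast hL
    calc (2 : ℝ) = 2 ^ 1 := by norm_num
      _ ≤ (L : ℝ) ^ 1 := by gcongr
      _ ≤ (L : ℝ) ^ d := pow_le_pow_right₀ (by linarith) hd
  push_cast
  rw [show d * (k + 1) = d * k + d by ring, pow_add]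
  have h0 : (0 : ℝ) ≤ (L : ℝ) ^ (d * k) := by positivity
  nlinarith

/-- linear weights: `L^{dk} 𝔥_k L^{−k|α|} ≤ ½ L^{d(k+1)} 𝔥_{k+1} L^{−(k+1)|α|}` for `2|α| ≤ d + 2`
(`d ≥ 3`, `L ≥ 4`). [cite: AdamsBuchholzKoteckyMuller2019, Lemma 10.5 (10.38)] -/
theorem abkm_weight_lin (hd : 3 ≤ d) (hL : 4 ≤ L) (hh : 0 < h) (k : ℕ) {a : ℕ} (ha : 2 * a ≤ d + 2) :
    ((L ^ (d * k) : ℕ) : ℝ) * (fieldWt h L d k * (((L : ℝ) ^ k) ^ a)⁻¹) ≤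
      (1 / 2 : ℝ) * (((L ^ (d * (k + 1)) : ℕ) : ℝ) * (fieldWt h L d (k + 1) * (((L : ℝ) ^ (k + 1)) ^ a)⁻¹)) := by
  have hL0 : (0 : ℝ) < L := by exact_mod_cast (show 0 < L by omega)
  have hL1 : (1 : ℝ) ≤ L := by exact_mod_cast (show 1 ≤ L by omega)
  have hκ := scaleRatio_pos (d := d) (show 0 < L by omega)
  have h𝔥 := fieldWt_pos hh hL0 d k
  rw [fieldWt_succ_nat (show 0 < L by omega) d k]
  push_cast
  rw [show d * (k + 1) = d * k + d by ring, pow_add]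
  -- reduce to `1 ≤ ½ κ L^d / L^a`
  have key : (1 : ℝ) ≤ (1 / 2 : ℝ) * scaleRatio d L * (L : ℝ) ^ d * ((L : ℝ) ^ a)⁻¹ := by
    -- square: `(½ κ L^d L^{-a})² = L^{2d} L^{-2a} / L^{d-2} = L^{d+2-2a} ≥ 1`
    set x := (1 / 2 : ℝ) * scaleRatio d L * (L : ℝ) ^ d * ((L : ℝ) ^ a)⁻¹ with hx
    have hx0 : 0 ≤ x := by positivity
    have hx2 : 1 ≤ x ^ 2 := by
      have hsq := scaleRatio_sq_mul (d := d) (show 0 < L by omega)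
      have hLa : (0 : ℝ) < (L : ℝ) ^ a := by positivity
      have hLd2 : (0 : ℝ) < (L : ℝ) ^ (d - 2) := by positivity
      have e : x ^ 2 * ((L : ℝ) ^ a) ^ 2 * (L : ℝ) ^ (d - 2) = ((L : ℝ) ^ d) ^ 2 := by
        rw [hx]
        field_simp
        nlinarith [hsq]
      have hpow : ((L : ℝ) ^ a) ^ 2 * (L : ℝ) ^ (d - 2) ≤ ((L : ℝ) ^ d) ^ 2 := by
        rw [← pow_mul, ← pow_add, ← pow_mul]
        exact pow_le_pow_right₀ hL1 (by omega)
      by_contra hlt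
      push Not at hlt
      have : x ^ 2 * (((L : ℝ) ^ a) ^ 2 * (L : ℝ) ^ (d - 2)) < 1 * ((L : ℝ) ^ d) ^ 2 := by
        calc x ^ 2 * (((L : ℝ) ^ a) ^ 2 * (L : ℝ) ^ (d - 2))
            < 1 * (((L : ℝ) ^ a) ^ 2 * (L : ℝ) ^ (d - 2)) :=
              mul_lt_mul_of_pos_right hlt (by positivity)
          _ ≤ 1 * ((L : ℝ) ^ d) ^ 2 := by rw [one_mul, one_mul]; exact hpow
      nlinarith [e]
    nlinarith
  have hpk : ((L : ℝ) ^ (k + 1)) ^ a = ((L : ℝ) ^ k) ^ a * (L : ℝ) ^ a := by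
    rw [pow_succ, mul_pow]
  rw [hpk, mul_inv]
  have hA : 0 ≤ (L : ℝ) ^ (d * k) * (fieldWt h (L : ℝ) d k * (((L : ℝ) ^ k) ^ a)⁻¹) := by positivity
  calc (L : ℝ) ^ (d * k) * (fieldWt h (L : ℝ) d k * (((L : ℝ) ^ k) ^ a)⁻¹)
      = (L : ℝ) ^ (d * k) * (fieldWt h (L : ℝ) d k * (((L : ℝ) ^ k) ^ a)⁻¹) * 1 := (mul_one _).symm
    _ ≤ (L : ℝ) ^ (d * k) * (fieldWt h (L : ℝ) d k * (((L : ℝ) ^ k) ^ a)⁻¹) *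
          ((1 / 2 : ℝ) * scaleRatio d L * (L : ℝ) ^ d * ((L : ℝ) ^ a)⁻¹) :=
        mul_le_mul_of_nonneg_left key hA
    _ = (1 / 2 : ℝ) * ((L : ℝ) ^ (d * k) * (L : ℝ) ^ d *
          (scaleRatio d L * fieldWt h (L : ℝ) d k * ((((L : ℝ) ^ k) ^ a)⁻¹ * ((L : ℝ) ^ a)⁻¹))) := by ring

/-- quadratic weights: `L^{dk}(𝔥_k/L^k)² ≤ ½ L^{d(k+1)}(𝔥_{k+1}/L^{k+1})²` (indeed with factor `2`).
[cite: AdamsBuchholzKoteckyMuller2019, Lemma 10.5 (10.38)] -/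
theorem abkm_weight_quad (hd : 2 ≤ d) (hL : 1 ≤ L) (k : ℕ) :
    ((L ^ (d * k) : ℕ) : ℝ) * (fieldWt h L d k / (L : ℝ) ^ k) ^ 2 ≤
      (1 / 2 : ℝ) * (((L ^ (d * (k + 1)) : ℕ) : ℝ) * (fieldWt h L d (k + 1) / (L : ℝ) ^ (k + 1)) ^ 2) := by
  have hL0 : (0 : ℝ) < L := by exact_mod_cast (show 0 < L by omega)
  rw [fieldWt_succ_nat (show 0 < L by omega) d k]
  push_cast
  rw [show d * (k + 1) = d * k + d by ring, pow_add]
  have hsq := scaleRatio_sq_mul (d := d) (show 0 < L by omega)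
  have hLd : (L : ℝ) ^ d = (L : ℝ) ^ (d - 2) * (L : ℝ) ^ 2 := by
    rw [← pow_add]; congr 1; omega
  -- `½ L^d κ² / L² = 2`
  have key : (1 / 2 : ℝ) * ((L : ℝ) ^ d * (scaleRatio d L / (L : ℝ)) ^ 2) = 2 := by
    rw [hLd, div_pow]
    field_simp
    nlinarith [hsq]
  have hLk : (L : ℝ) ^ (k + 1) = (L : ℝ) ^ k * L := pow_succ _ _
  have e : (1 / 2 : ℝ) * ((L : ℝ) ^ (d * k) * (L : ℝ) ^ d *
      (scaleRatio d L * fieldWt h (L : ℝ) d k / (L : ℝ) ^ (k + 1)) ^ 2) =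
      (1 / 2 : ℝ) * ((L : ℝ) ^ d * (scaleRatio d L / (L : ℝ)) ^ 2) *
        ((L : ℝ) ^ (d * k) * (fieldWt h (L : ℝ) d k / (L : ℝ) ^ k) ^ 2) := by
    rw [hLk]
    field_simp
  rw [e, key]
  have h0 : 0 ≤ (L : ℝ) ^ (d * k) * (fieldWt h (L : ℝ) d k / (L : ℝ) ^ k) ^ 2 := by positivity
  linarith

/-- the shift: `L^{dk}|γ_q| ≤ ¼ L^{d(k+1)}(𝔥_{k+1}/L^{k+1})² = 4^k h²` whenever `L^{dk}|γ_q| ≤ h²`.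
[cite: AdamsBuchholzKoteckyMuller2019, Lemma 10.5 (10.39)] -/
theorem abkm_weight_shift (hd : 2 ≤ d) (hL : 1 ≤ L) (k : ℕ) {g : ℝ}
    (hg : ((L ^ (d * k) : ℕ) : ℝ) * |g| ≤ h ^ 2) :
    ((L ^ (d * k) : ℕ) : ℝ) * |g| ≤
      (1 / 4 : ℝ) * (((L ^ (d * (k + 1)) : ℕ) : ℝ) * (fieldWt h L d (k + 1) / (L : ℝ) ^ (k + 1)) ^ 2) := by
  have hL0 : (0 : ℝ) < L := by exact_mod_cast (show 0 < L by omega)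
  have hsq := fieldWt_sq_mul (h := h) hL0 d (k + 1)
  rw [hScale_sq] at hsq
  -- `¼ L^{d(k+1)} 𝔥_{k+1}² / L^{2(k+1)} = ¼ · 4^{k+1} h² = 4^k h²`
  have key : (1 / 4 : ℝ) * (((L ^ (d * (k + 1)) : ℕ) : ℝ) * (fieldWt h L d (k + 1) / (L : ℝ) ^ (k + 1)) ^ 2)
      = 4 ^ k * h ^ 2 := by
    push_cast
    have hLp : (L : ℝ) ^ (d * (k + 1)) = ((L : ℝ) ^ (k + 1)) ^ (d - 2) * ((L : ℝ) ^ (k + 1)) ^ 2 := by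
      rw [← pow_mul, ← pow_mul, ← pow_add]; congr 1
      have : d = (d - 2) + 2 := by omega
      conv_lhs => rw [this]
      ring
    rw [hLp, div_pow]
    have hne : ((L : ℝ) ^ (k + 1)) ^ 2 ≠ 0 := by positivity
    calc (1 / 4 : ℝ) * (((L : ℝ) ^ (k + 1)) ^ (d - 2) * ((L : ℝ) ^ (k + 1)) ^ 2 *
          (fieldWt h (L : ℝ) d (k + 1) ^ 2 / ((L : ℝ) ^ (k + 1)) ^ 2))
        = (1 / 4 : ℝ) * (fieldWt h (L : ℝ) d (k + 1) ^ 2 * ((L : ℝ) ^ (k + 1)) ^ (d - 2)) := by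
          field_simp
      _ = 4 ^ k * h ^ 2 := by rw [hsq, pow_succ]; ring
  rw [key]
  have h4 : (1 : ℝ) ≤ 4 ^ k := one_le_pow₀ (by norm_num)
  have hh2 : 0 ≤ h ^ 2 := sq_nonneg h
  nlinarith

end Weights

/-! ## Lemma 10.5 for the concrete scales -/

/-- **[ABKM19] Lemma 10.5 for the torus scales**: for `d ≥ 3`, `L ≥ 4`, `h > 0` and a shift with
`L^{dk}|γ_q| ≤ h²` for all `q` ((10.39): `|γ_q| ≤ C_{2,0}L^{−dk}` and `h² ≥ C_{2,0}`),
`‖A_k⁻¹H'‖_{k,0} ≤ ¾ ‖H'‖_{k+1,0}` with the coefficient norms at the weights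
`(fieldWt h L d k, L^k, L^{dk})` and `(fieldWt h L d (k+1), L^{k+1}, L^{d(k+1)})`.
[cite: AdamsBuchholzKoteckyMuller2019, Lemma 10.5] -/
theorem hamNorm_stepOpAInv_abkm_le {𝕜 : Type*} [NormedField 𝕜] [NormedAlgebra ℝ 𝕜] [NormOneClass 𝕜]
    {L : ℕ} {h : ℝ} (hd : 3 ≤ d) (hL : 4 ≤ L) (hh : 0 < h) (k : ℕ) {γ : quadIndex d → ℝ}
    (hγ : ∀ q, ((L ^ (d * k) : ℕ) : ℝ) * |γ q| ≤ h ^ 2) (H' : RelevantHamiltonian 𝕜 d) :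
    hamNorm (fieldWt h L d k) ((L : ℝ) ^ k) (L ^ (d * k)) (stepOpAInv γ H') ≤
      (3 / 4 : ℝ) * hamNorm (fieldWt h L d (k + 1)) ((L : ℝ) ^ (k + 1)) (L ^ (d * (k + 1))) H' := by
  have hL0 : (0 : ℝ) < L := by exact_mod_cast (show 0 < L by omega)
  refine hamNorm_stepOpAInv_le (fieldWt_pos hh hL0 d (k + 1)).le (by positivity)
    (abkm_weight_const (by omega) (by omega) k) (fun α => ?_) (abkm_weight_quad (by omega) (by omega) k)
    (fun q => abkm_weight_shift (by omega) (by omega) k (hγ q)) H'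
  have hα := (mem_linIndex.1 α.2).2
  exact abkm_weight_lin hd hL hh k (by omega)

end Literature.MathematicalPhysics.StatisticalMechanics.GradientRG

end
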